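import Summits.Ventures.Crystal3D.Theorems.StickyWulffConstantGenericWallFloorExitLocation
import HarnessLib

/-!
# Payers carry no outer vacancy: no exit is born within four of a face layer

HONEST FRAMING. Part of the venture `Summits/Ventures/Crystal3D` (cell `crystal3d-full`), helper for the
crux `GenericWallFloor` (stmt-Ventures-19480) of `route-Ventures-StickyWulffConstant`, REGISTERED line
`WallLedgerG` (planner cf-p1 gen 16), stub `stub_twoSlabAdhesion : TwoSlabAdhesion` (THE CRUX of the line).
Bookkeeping for the two-grain general-filling ledger (`…GeneralLedger`): an unsaturated ball `y` within
contact distance `3` of an exit `e` (of either grain) is never a non-rim ball of the bottom sample with an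
outer (downward) vacancy, nor of the top sample with an upward vacancy — because the exit's full-shell
predecessor would then sit deep inside the clamped slab, which `…ExitLocation` forbids.  Four cases
(bottom/top × own/other grain).  Rung credit only; F-C1 not moved.
-/

noncomputable section

namespace Summit.Ventures.Crystal3D.Theorems

open Summit.Ventures.Crystal3D Finset
open Literature.MathematicalPhysics.StatisticalMechanics (fccStacking)
open scoped InnerProductSpace

/-- Contact distance at most three ⇒ Euclidean distance at most three. -/
theorem dist_le_three_of_withinThree {X : Finset (EuclideanSpace ℝ (Fin 3))} {e y : EuclideanSpace ℝ (Fin 3)}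
    (h : y = e ∨ dist e y = 1 ∨ (∃ z ∈ X, dist e z = 1 ∧ dist z y = 1) ∨
      ∃ z ∈ X, ∃ z' ∈ X, dist e z = 1 ∧ dist z z' = 1 ∧ dist z' y = 1) : dist e y ≤ 3 := by
  rcases h with rfl | h | ⟨z, -, h1, h2⟩ | ⟨z, -, z', -, h1, h2, h3⟩
  · simp
  · linarith
  · linarith [dist_triangle e z y]
  · linarith [dist_triangle e z y, dist_triangle z z' y]

/-- Geometry of a predecessor near a low ball: if `dist e y ≤ 3`, `‖v‖ = 1`, `y` is off the rim
(`lateral ≤ (ρ − 8)²`, `ρ ≥ 8`), then `e − v` has lateral radius `≤ (ρ − 2)²` and `|(e − v)₂ − y₂| ≤ 4`. -/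
theorem pred_near {e y v : EuclideanSpace ℝ (Fin 3)} {ρ : ℝ} (hρ : 8 ≤ ρ) (hd : dist e y ≤ 3) (hv : ‖v‖ = 1)
    (hy : y 0 ^ 2 + y 1 ^ 2 ≤ (ρ - 8) ^ 2) :
    (e - v) 0 ^ 2 + (e - v) 1 ^ 2 ≤ (ρ - 2) ^ 2 ∧ (e - v) 2 ≤ y 2 + 4 ∧ y 2 - 4 ≤ (e - v) 2 := by
  have hdist : dist (e - v) y ≤ 4 := by
    have h1 := dist_triangle (e - v) e y
    have h2 : dist (e - v) e = 1 := by rw [dist_eq_norm, sub_sub_cancel_left, norm_neg, hv]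
    linarith
  have h1 := lateral_radius_le_add_dist (e - v) y
  have hsy : Real.sqrt (y 0 ^ 2 + y 1 ^ 2) ≤ ρ - 8 := by
    rw [← Real.sqrt_sq (by linarith : (0:ℝ) ≤ ρ - 8)]; exact Real.sqrt_le_sqrt hy
  have h5 : Real.sqrt ((e - v) 0 ^ 2 + (e - v) 1 ^ 2) ≤ ρ - 2 := by linarith
  have h6 := Real.sq_sqrt (by positivity : (0:ℝ) ≤ (e - v) 0 ^ 2 + (e - v) 1 ^ 2)
  have h7 := Real.sqrt_nonneg ((e - v) 0 ^ 2 + (e - v) 1 ^ 2)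
  have h8 := abs_apply_sub_le_dist (e - v) y 2
  obtain ⟨h9, h10⟩ := abs_le.1 (h8.trans hdist)
  exact ⟨by nlinarith, by linarith, by linarith⟩

/-- A non-rim bottom-sample ball with a DOWNWARD vacancy lies in the bottom layer: `y₂ < −2R₀ + 1`. -/
theorem low_of_down_vacancy
    (A : EuclideanSpace ℝ (Fin 3) ≃ₗᵢ[ℝ] EuclideanSpace ℝ (Fin 3)) (t : EuclideanSpace ℝ (Fin 3))
    (P : Finset (EuclideanSpace ℝ (Fin 3))) (R₀ ρ : ℝ) (hρ : 8 ≤ ρ)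
    (hP : ∀ p, p ∈ P ↔ (p ∈ (fun q => A q + t) '' fccStacking 1 (Real.sqrt (2 / 3)) ∧
      -(2 * R₀) ≤ p 2 ∧ p 2 ≤ -R₀ ∧ p 0 ^ 2 + p 1 ^ 2 ≤ ρ ^ 2))
    {y w : EuclideanSpace ℝ (Fin 3)} (hy : y ∈ P) (hw : w ∈ fccSlots)
    (hα : ⟪A w, EuclideanSpace.single (2 : Fin 3) (1 : ℝ)⟫_ℝ < 0) (hvac : y + A w ∉ P)
    (hrim : y 0 ^ 2 + y 1 ^ 2 ≤ (ρ - 8) ^ 2) : y 2 < -(2 * R₀) + 1 := by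
  by_contra hge
  push Not at hge
  apply hvac
  obtain ⟨hyΛ, hy1, hy2, hy3⟩ := (hP y).1 hy
  rw [hP]
  have hα' := abs_le.1 (abs_inner_slot_le_one A hw)
  have e2 : (y + A w) 2 = y 2 + ⟪A w, EuclideanSpace.single (2 : Fin 3) (1 : ℝ)⟫_ℝ := by
    rw [PiLp.add_apply, apply_two_eq_inner_e₃ (A w)]
  have hlat := lateral_sq_add_le y (A w) (by linarith : (0:ℝ) ≤ ρ - 8) hrim
  rw [LinearIsometryEquiv.norm_map, norm_eq_one_of_mem_fccSlots hw] at hlat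
  exact ⟨movedFcc_add_site_mem A t hyΛ (mem_fcc_of_mem_fccSlots hw), by rw [e2]; linarith,
    by rw [e2]; linarith, by nlinarith⟩

/-- A non-rim top-sample ball with an UPWARD vacancy lies in the top layer: `y₂ > h + 2R₀ − 1`. -/
theorem high_of_up_vacancy
    (A : EuclideanSpace ℝ (Fin 3) ≃ₗᵢ[ℝ] EuclideanSpace ℝ (Fin 3)) (t : EuclideanSpace ℝ (Fin 3))
    (P : Finset (EuclideanSpace ℝ (Fin 3))) (R₀ h ρ : ℝ) (hρ : 8 ≤ ρ)
    (hP : ∀ p, p ∈ P ↔ (p ∈ (fun q => A q + t) '' fccStacking 1 (Real.sqrt (2 / 3)) ∧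
      h + R₀ ≤ p 2 ∧ p 2 ≤ h + 2 * R₀ ∧ p 0 ^ 2 + p 1 ^ 2 ≤ ρ ^ 2))
    {y w : EuclideanSpace ℝ (Fin 3)} (hy : y ∈ P) (hw : w ∈ fccSlots)
    (hα : 0 < ⟪A w, EuclideanSpace.single (2 : Fin 3) (1 : ℝ)⟫_ℝ) (hvac : y + A w ∉ P)
    (hrim : y 0 ^ 2 + y 1 ^ 2 ≤ (ρ - 8) ^ 2) : h + 2 * R₀ - 1 < y 2 := by
  by_contra hle
  push Not at hle
  apply hvac
  obtain ⟨hyΛ, hy1, hy2, hy3⟩ := (hP y).1 hy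
  rw [hP]
  have hα' := abs_le.1 (abs_inner_slot_le_one A hw)
  have e2 : (y + A w) 2 = y 2 + ⟪A w, EuclideanSpace.single (2 : Fin 3) (1 : ℝ)⟫_ℝ := by
    rw [PiLp.add_apply, apply_two_eq_inner_e₃ (A w)]
  have hlat := lateral_sq_add_le y (A w) (by linarith : (0:ℝ) ≤ ρ - 8) hrim
  rw [LinearIsometryEquiv.norm_map, norm_eq_one_of_mem_fccSlots hw] at hlat
  exact ⟨movedFcc_add_site_mem A t hyΛ (mem_fcc_of_mem_fccSlots hw), by rw [e2]; linarith,
    by rw [e2]; linarith, by nlinarith⟩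

/-- **No exit of ANY frame `B` within three of a bottom-layer ball, own-grain form**: if `y₂ < −2R₀ + 1`,
`y` off the rim, `dist e y ≤ 3`, `e − B u ∈ X` with full `B`-shell where `B = A` is the grain's own frame and
`u` a steep up-slot, then every slot of `e` is occupied. -/
theorem slots_full_of_near_bottom_layer
    (A : EuclideanSpace ℝ (Fin 3) ≃ₗᵢ[ℝ] EuclideanSpace ℝ (Fin 3)) (t : EuclideanSpace ℝ (Fin 3))
    (X P : Finset (EuclideanSpace ℝ (Fin 3))) (R₀ ρ : ℝ) (hR₀ : 8 ≤ R₀) (hρ : R₀ ≤ ρ)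
    (hX : ∀ p ∈ X, ∀ q ∈ X, p ≠ q → 1 ≤ dist p q) (hPX : P ⊆ X)
    (hcell : ∀ p ∈ X, -(2 * R₀) ≤ p 2)
    (hP : ∀ p, p ∈ P ↔ (p ∈ (fun q => A q + t) '' fccStacking 1 (Real.sqrt (2 / 3)) ∧
      -(2 * R₀) ≤ p 2 ∧ p 2 ≤ -R₀ ∧ p 0 ^ 2 + p 1 ^ 2 ≤ ρ ^ 2))
    (hclean : ∀ p ∈ X, p 2 < -(2 * R₀) + 1 → p ∈ (fun q => A q + t) '' fccStacking 1 (Real.sqrt (2 / 3)))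
    {u : EuclideanSpace ℝ (Fin 3)} (hu : u ∈ fccSlots)
    (hsteep : Real.sqrt 2 / 2 ≤ ⟪A u, EuclideanSpace.single (2 : Fin 3) (1 : ℝ)⟫_ℝ)
    {e y : EuclideanSpace ℝ (Fin 3)} (hd : e - A u ∈ X) (hfull : ∀ w ∈ fccSlots, e - A u + A w ∈ X)
    (hylow : y 2 < -(2 * R₀) + 1) (hyr : y 0 ^ 2 + y 1 ^ 2 ≤ (ρ - 8) ^ 2) (hdist : dist e y ≤ 3)
    {v : EuclideanSpace ℝ (Fin 3)} (hv : v ∈ fccSlots) : e + A v ∈ X := by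
  have hAu : ‖A u‖ = 1 := by rw [LinearIsometryEquiv.norm_map, norm_eq_one_of_mem_fccSlots hu]
  obtain ⟨hlat, hz, -⟩ := pred_near (by linarith) hdist hAu hyr
  have hmem := slot_mem_of_full_shell_bottom A t X P R₀ ρ (by linarith) hρ hX hPX hcell hP hclean hd hfull
    (by linarith) hlat hu hsteep hv
  rwa [sub_add_cancel] at hmem

/-- **Other-grain form**: under the same geometry, a full `B`-shell for ANOTHER frame `B` forces all slot
vectors of `B` into the grain's linear lattice. -/
theorem frame_slots_subset_of_near_bottom_layer
    (A : EuclideanSpace ℝ (Fin 3) ≃ₗᵢ[ℝ] EuclideanSpace ℝ (Fin 3)) (t : EuclideanSpace ℝ (Fin 3))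
    (X P : Finset (EuclideanSpace ℝ (Fin 3))) (R₀ ρ : ℝ) (hR₀ : 8 ≤ R₀) (hρ : R₀ ≤ ρ)
    (hX : ∀ p ∈ X, ∀ q ∈ X, p ≠ q → 1 ≤ dist p q) (hPX : P ⊆ X)
    (hcell : ∀ p ∈ X, -(2 * R₀) ≤ p 2)
    (hP : ∀ p, p ∈ P ↔ (p ∈ (fun q => A q + t) '' fccStacking 1 (Real.sqrt (2 / 3)) ∧
      -(2 * R₀) ≤ p 2 ∧ p 2 ≤ -R₀ ∧ p 0 ^ 2 + p 1 ^ 2 ≤ ρ ^ 2))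
    (hclean : ∀ p ∈ X, p 2 < -(2 * R₀) + 1 → p ∈ (fun q => A q + t) '' fccStacking 1 (Real.sqrt (2 / 3)))
    (B : EuclideanSpace ℝ (Fin 3) ≃ₗᵢ[ℝ] EuclideanSpace ℝ (Fin 3)) {u : EuclideanSpace ℝ (Fin 3)}
    (hu : u ∈ fccSlots) {e y : EuclideanSpace ℝ (Fin 3)} (hd : e - B u ∈ X)
    (hfull : ∀ w ∈ fccSlots, e - B u + B w ∈ X)
    (hylow : y 2 < -(2 * R₀) + 1) (hyr : y 0 ^ 2 + y 1 ^ 2 ≤ (ρ - 8) ^ 2) (hdist : dist e y ≤ 3) :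
    ∀ w ∈ fccSlots, B w ∈ A '' fccStacking 1 (Real.sqrt (2 / 3)) := by
  have hBu : ‖B u‖ = 1 := by rw [LinearIsometryEquiv.norm_map, norm_eq_one_of_mem_fccSlots hu]
  obtain ⟨hlat, hz, -⟩ := pred_near (by linarith) hdist hBu hyr
  exact frame_slots_subset_of_full_shell_bottom A t X P R₀ ρ (by linarith) hρ hX hPX hcell hP hclean B hd hfull
    (by linarith) hlat

/-- **Top-layer, own-grain form** (steep DOWN-slot `u`). -/
theorem slots_full_of_near_top_layer
    (A : EuclideanSpace ℝ (Fin 3) ≃ₗᵢ[ℝ] EuclideanSpace ℝ (Fin 3)) (t : EuclideanSpace ℝ (Fin 3))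
    (X P : Finset (EuclideanSpace ℝ (Fin 3))) (R₀ h ρ : ℝ) (hR₀ : 8 ≤ R₀) (hρ : R₀ ≤ ρ)
    (hX : ∀ p ∈ X, ∀ q ∈ X, p ≠ q → 1 ≤ dist p q) (hPX : P ⊆ X)
    (hcell : ∀ p ∈ X, p 2 ≤ h + 2 * R₀)
    (hP : ∀ p, p ∈ P ↔ (p ∈ (fun q => A q + t) '' fccStacking 1 (Real.sqrt (2 / 3)) ∧
      h + R₀ ≤ p 2 ∧ p 2 ≤ h + 2 * R₀ ∧ p 0 ^ 2 + p 1 ^ 2 ≤ ρ ^ 2))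
    (hclean : ∀ p ∈ X, h + 2 * R₀ - 1 < p 2 → p ∈ (fun q => A q + t) '' fccStacking 1 (Real.sqrt (2 / 3)))
    {u : EuclideanSpace ℝ (Fin 3)} (hu : u ∈ fccSlots)
    (hsteep : ⟪A u, EuclideanSpace.single (2 : Fin 3) (1 : ℝ)⟫_ℝ ≤ -(Real.sqrt 2 / 2))
    {e y : EuclideanSpace ℝ (Fin 3)} (hd : e - A u ∈ X) (hfull : ∀ w ∈ fccSlots, e - A u + A w ∈ X)
    (hyhigh : h + 2 * R₀ - 1 < y 2) (hyr : y 0 ^ 2 + y 1 ^ 2 ≤ (ρ - 8) ^ 2) (hdist : dist e y ≤ 3)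
    {v : EuclideanSpace ℝ (Fin 3)} (hv : v ∈ fccSlots) : e + A v ∈ X := by
  have hAu : ‖A u‖ = 1 := by rw [LinearIsometryEquiv.norm_map, norm_eq_one_of_mem_fccSlots hu]
  obtain ⟨hlat, -, hz⟩ := pred_near (by linarith) hdist hAu hyr
  have hmem := slot_mem_of_full_shell_top A t X P R₀ h ρ (by linarith) hρ hX hPX hcell hP hclean hd hfull
    (by linarith) hlat hu hsteep hv
  rwa [sub_add_cancel] at hmem

/-- **Top-layer, other-grain form**. -/
theorem frame_slots_subset_of_near_top_layer
    (A : EuclideanSpace ℝ (Fin 3) ≃ₗᵢ[ℝ] EuclideanSpace ℝ (Fin 3)) (t : EuclideanSpace ℝ (Fin 3))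
    (X P : Finset (EuclideanSpace ℝ (Fin 3))) (R₀ h ρ : ℝ) (hR₀ : 8 ≤ R₀) (hρ : R₀ ≤ ρ)
    (hX : ∀ p ∈ X, ∀ q ∈ X, p ≠ q → 1 ≤ dist p q) (hPX : P ⊆ X)
    (hcell : ∀ p ∈ X, p 2 ≤ h + 2 * R₀)
    (hP : ∀ p, p ∈ P ↔ (p ∈ (fun q => A q + t) '' fccStacking 1 (Real.sqrt (2 / 3)) ∧
      h + R₀ ≤ p 2 ∧ p 2 ≤ h + 2 * R₀ ∧ p 0 ^ 2 + p 1 ^ 2 ≤ ρ ^ 2))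
    (hclean : ∀ p ∈ X, h + 2 * R₀ - 1 < p 2 → p ∈ (fun q => A q + t) '' fccStacking 1 (Real.sqrt (2 / 3)))
    (B : EuclideanSpace ℝ (Fin 3) ≃ₗᵢ[ℝ] EuclideanSpace ℝ (Fin 3)) {u : EuclideanSpace ℝ (Fin 3)}
    (hu : u ∈ fccSlots) {e y : EuclideanSpace ℝ (Fin 3)} (hd : e - B u ∈ X)
    (hfull : ∀ w ∈ fccSlots, e - B u + B w ∈ X)
    (hyhigh : h + 2 * R₀ - 1 < y 2) (hyr : y 0 ^ 2 + y 1 ^ 2 ≤ (ρ - 8) ^ 2) (hdist : dist e y ≤ 3) :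
    ∀ w ∈ fccSlots, B w ∈ A '' fccStacking 1 (Real.sqrt (2 / 3)) := by
  have hBu : ‖B u‖ = 1 := by rw [LinearIsometryEquiv.norm_map, norm_eq_one_of_mem_fccSlots hu]
  obtain ⟨hlat, -, hz⟩ := pred_near (by linarith) hdist hBu hyr
  exact frame_slots_subset_of_full_shell_top A t X P R₀ h ρ (by linarith) hρ hX hPX hcell hP hclean B hd hfull
    (by linarith) hlat

end Summit.Ventures.Crystal3D.Theorems

end
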